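import Summits.QuantumAdvantage.QuantumAdvantage.Theorems.ReadDialEndShadowA

/-! # ReadDialEndShadow — part 2/2 (mechanical split for landing of `ReadDialEndShadow`; content verbatim; scopes re-opened with their variables) -/

set_option linter.dupNamespace false
noncomputable section
open Finset

namespace Summit.QuantumAdvantage.QuantumAdvantage.Theorems.ReadDial

/-! ## §3  THE END-SHADOW LAW.

For a strategy on `N = m + s + 2` bits whose cuts at positions `< m` do not read the last two bits ("blind"), sum the
winning identity over the three FACES `f ∈ {00, 01, 11}` of the last two bits at the points `w ++ 0^s ++ f`: a blind cut
`g ≤ m` has `x_g = c + g + |w| + W_g(w) + |f|`, live for exactly two of the three faces, so all blind fires cancel mod 2.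
What remains — the end cuts `g ≥ m` — see the free block only through `2|w| mod 3 =: t`, so their contribution is the
SHADOW `J_t(w)`, the parity of `≤ 3(s+3)` Booleans of degree `≤ d`.  Perfection forces `J_t ≡ 1` on the weight class
`{2|w| ≡ t}`; exact Hegedűs (§1) spreads it to all `w`, for `t = 0, 1, 2`; but `J_0 ⊕ J_1 ⊕ J_2 ≡ 0` pointwise (each
end fire is live for exactly two classes).  Contradiction: NO SUCH STRATEGY IS PERFECT. -/

section Law

open Summit.QuantumAdvantage.AdviceFreeQNC0
open Literature.Computability.MetaComplexity Literature.Computability.MetaComplexity.Smolensky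
open Summit.QuantumAdvantage.QuantumAdvantage.Theorems.AbsorptionDial

variable {m s : ℕ}

/-- ReadDialEndShadow helper `hasDegF_mono` (decomp-qadv land package; see the module docstring). -/
private theorem hasDegF_mono {p : ℕ} [Fact p.Prime] {k d d' : ℕ} {f : (Fin k → Bool) → Bool} (hf : HasDegF p f d)
    (h : d ≤ d') : HasDegF p f d' := by
  unfold HasDegF at *
  exact lowDeg_mono h hf

/-- the LIVENESS BRACKET of the end cut at position `g ≥ m`, face `j`, free-block class `t = 2|w| mod 3`. -/
def br (m s c t g : ℕ) (j : Fin 3) : Bool :=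
  decide ((c + g + t + (j.val + wtPrefix (face j) (g - (m + s)))) % 3 ≠ 0)

/-- the END CUTS: positions `≥ m` (the last `s + 3` cuts). -/
def endCuts (m s : ℕ) : Finset (Fin (m + s + 2 + 1)) := univ.filter fun g => ¬ g.val < m

/-- (end cut, face) pairs live under class `t`. -/
def liveIdx (m s c t : ℕ) : Finset (Fin (m + s + 2 + 1) × Fin 3) :=
  (endCuts m s ×ˢ (univ : Finset (Fin 3))).filter fun gj => br m s c t gj.1.val gj.2 = true

/-- **THE SHADOW** `J_t(w)`: the parity of the live end fires over the three faces, under class `t`. -/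
def shadow (c : ℕ) (y : Fin (m + s + 2 + 1) → (Fin (m + s + 2) → Bool) → Bool) (t : ℕ) (w : Fin m → Bool) :
    Bool :=
  decide (((liveIdx m s c t).filter fun gj => y gj.1 (pt m s w (face gj.2)) = true).card % 2 = 1)

/-- ReadDialEndShadow helper `card_endCuts` (decomp-qadv land package; see the module docstring). -/
theorem card_endCuts : (endCuts m s).card = s + 3 := by
  have h := Finset.card_filter_add_card_filter_not (s := (univ : Finset (Fin (m + s + 2 + 1))))
    (p := fun g : Fin (m + s + 2 + 1) => g.val < m)
  rw [Fin.card_filter_val_lt, Finset.card_univ, Fintype.card_fin] at h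
  unfold endCuts
  rw [Nat.min_eq_right (by omega)] at h
  omega

/-- ReadDialEndShadow helper `card_liveIdx_le` (decomp-qadv land package; see the module docstring). -/
theorem card_liveIdx_le (c t : ℕ) : (liveIdx m s c t).card ≤ 3 * (s + 3) := by
  unfold liveIdx
  refine le_trans (Finset.card_filter_le _ _) ?_
  rw [Finset.card_product, card_endCuts, Finset.card_univ, Fintype.card_fin]
  omega

/-- the shadow has `𝔽_p`-degree `≤ 3(s+3)·d` (parities cost: degrees add, `hasDegF_parity`). -/
theorem hasDegF_shadow {p : ℕ} [Fact p.Prime] {d : ℕ} (c : ℕ)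
    {y : Fin (m + s + 2 + 1) → (Fin (m + s + 2) → Bool) → Bool}
    (hdeg : ∀ g : Fin (m + s + 2 + 1), m ≤ g.val → HasDegF p (y g) d) (t : ℕ) :
    HasDegF p (shadow c y t) (3 * (s + 3) * d) := by
  have h := hasDegF_parity (p := p) (liveIdx m s c t) (fun gj (w : Fin m → Bool) => y gj.1 (pt m s w (face gj.2)))
    (fun gj hgj => by
      have hg : m ≤ gj.1.val := by
        have h1 := (Finset.mem_filter.mp hgj).1
        rw [Finset.mem_product] at h1
        have h2 := (Finset.mem_filter.mp h1.1).2
        omega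
      exact hasDegF_pt (hdeg gj.1 hg) (face gj.2))
  exact hasDegF_mono h (Nat.mul_le_mul_right _ (card_liveIdx_le c t))

/-- three parities of even total XOR to `false`. -/
private theorem xor3_false_of_even {a b e : ℕ} (h : (a + b + e) % 2 = 0) :
    Bool.xor (Bool.xor (decide (a % 2 = 1)) (decide (b % 2 = 1))) (decide (e % 2 = 1)) = false := by
  rcases Nat.mod_two_eq_zero_or_one a with ha | ha <;> rcases Nat.mod_two_eq_zero_or_one b with hb | hb <;>
    rcases Nat.mod_two_eq_zero_or_one e with he | he <;> simp [ha, hb, he] <;> omega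

/-- **pointwise**: `J_0 ⊕ J_1 ⊕ J_2 ≡ 0` — every end fire is live under exactly two of the three classes. -/
theorem shadow_xor3 (c : ℕ) (y : Fin (m + s + 2 + 1) → (Fin (m + s + 2) → Bool) → Bool) (w : Fin m → Bool) :
    Bool.xor (Bool.xor (shadow c y 0 w) (shadow c y 1 w)) (shadow c y 2 w) = false := by
  have hc : ∀ t, ((liveIdx m s c t).filter fun gj => y gj.1 (pt m s w (face gj.2)) = true).card =
      ∑ gj ∈ endCuts m s ×ˢ (univ : Finset (Fin 3)),
        (if br m s c t gj.1.val gj.2 = true ∧ y gj.1 (pt m s w (face gj.2)) = true then 1 else 0) := by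
    intro t; unfold liveIdx; rw [Finset.filter_filter, Finset.card_filter]
  apply xor3_false_of_even
  rw [hc 0, hc 1, hc 2, ← Finset.sum_add_distrib, ← Finset.sum_add_distrib]
  have hpt : ∀ gj ∈ endCuts m s ×ˢ (univ : Finset (Fin 3)),
      ((if br m s c 0 gj.1.val gj.2 = true ∧ y gj.1 (pt m s w (face gj.2)) = true then 1 else 0) +
        (if br m s c 1 gj.1.val gj.2 = true ∧ y gj.1 (pt m s w (face gj.2)) = true then 1 else 0) +
        (if br m s c 2 gj.1.val gj.2 = true ∧ y gj.1 (pt m s w (face gj.2)) = true then 1 else 0)) =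
      2 * (if y gj.1 (pt m s w (face gj.2)) = true then 1 else 0) := by
    intro gj _
    unfold br
    by_cases hy : y gj.1 (pt m s w (face gj.2)) = true
    · simp only [hy, and_true, decide_eq_true_eq, if_true]
      split_ifs <;> omega
    · simp [hy]
  rw [Finset.sum_congr rfl hpt, ← Finset.mul_sum]
  omega

/-- **the class identity**: perfection + blindness ⟹ `J_{2|w| mod 3}(w) = 1` for every free block `w`. -/
theorem shadow_class (c : ℕ) (y : Fin (m + s + 2 + 1) → (Fin (m + s + 2) → Bool) → Bool)
    (hwin : ∀ u, ringWinU c y u = true)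
    (hblind : ∀ g : Fin (m + s + 2 + 1), g.val < m → ∀ u u' : Fin (m + s + 2) → Bool,
      (∀ i : Fin (m + s + 2), i.val < m + s → u i = u' i) → y g u = y g u') (w : Fin m → Bool) :
    shadow c y ((2 * wt w) % 3) w = true := by
  set t := (2 * wt w) % 3 with ht
  -- the three winning counts, as sums
  have hcnt : ∀ j : Fin 3, (∑ g : Fin (m + s + 2 + 1),
      (if y g (pt m s w (face j)) = true ∧ (c + g.val + walkExp (pt m s w (face j)) g.val) % 3 ≠ 0 then 1 else 0))
        % 2 = 1 := by
    intro j
    have h := hwin (pt m s w (face j))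
    unfold ringWinU at h
    rw [decide_eq_true_eq, Finset.card_filter] at h
    exact h
  -- split each count at position `m`: blind part `B j` + end part `T j`
  set B : Fin 3 → ℕ := fun j => ∑ g ∈ (univ : Finset (Fin (m + s + 2 + 1))).filter (fun g => g.val < m),
      (if y g (pt m s w (face j)) = true ∧ (c + g.val + walkExp (pt m s w (face j)) g.val) % 3 ≠ 0 then 1 else 0)
    with hB
  set T : Fin 3 → ℕ := fun j => ∑ g ∈ endCuts m s,
      (if y g (pt m s w (face j)) = true ∧ (c + g.val + walkExp (pt m s w (face j)) g.val) % 3 ≠ 0 then 1 else 0)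
    with hT
  have hsplit : ∀ j : Fin 3, (∑ g : Fin (m + s + 2 + 1),
      (if y g (pt m s w (face j)) = true ∧ (c + g.val + walkExp (pt m s w (face j)) g.val) % 3 ≠ 0 then 1 else 0))
        = B j + T j := by
    intro j
    rw [hB, hT]
    unfold endCuts
    exact (Finset.sum_filter_add_sum_filter_not univ (fun g : Fin (m + s + 2 + 1) => g.val < m) _).symm
  -- BLIND CANCELLATION: `B 0 + B 1 + B 2` is even
  have hBeven : B 0 + B 1 + B 2 = 2 * ∑ g ∈ (univ : Finset (Fin (m + s + 2 + 1))).filter (fun g => g.val < m),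
      (if y g (pt m s w (face 0)) = true then 1 else 0) := by
    rw [hB, Finset.mul_sum, ← Finset.sum_add_distrib, ← Finset.sum_add_distrib]
    refine Finset.sum_congr rfl fun g hg => ?_
    have hgm : g.val < m := (Finset.mem_filter.mp hg).2
    have hy : ∀ j : Fin 3, y g (pt m s w (face j)) = y g (pt m s w (face 0)) := fun j =>
      hblind g hgm _ _ (fun i hi => pt_congr w _ _ i hi)
    have hx : ∀ j : Fin 3, walkExp (pt m s w (face j)) g.val = wt w + wtPrefix w g.val + j.val := fun j => by
      rw [walkExp_pt_le w _ (le_of_lt hgm), wt_face]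
    rw [hy 1, hy 2, hx 0, hx 1, hx 2]
    by_cases hY : y g (pt m s w (face 0)) = true
    · simp only [hY, true_and, if_true, Fin.isValue, Fin.val_zero, Fin.val_one, Fin.val_two]
      split_ifs <;> omega
    · simp [hY]
  -- END PART: liveness is the bracket under class `t`
  have hTbr : ∀ j : Fin 3, T j = ∑ g ∈ endCuts m s,
      (if br m s c t g.val j = true ∧ y g (pt m s w (face j)) = true then 1 else 0) := by
    intro j
    rw [hT]
    refine Finset.sum_congr rfl fun g hg => ?_
    have hgm : m ≤ g.val := by have := (Finset.mem_filter.mp hg).2; omega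
    have hiff : ((c + g.val + walkExp (pt m s w (face j)) g.val) % 3 ≠ 0) ↔ br m s c t g.val j = true := by
      rw [walkExp_pt_ge w _ hgm, wt_face]
      unfold br
      rw [decide_eq_true_eq, ht]
      constructor <;> intro h <;> omega
    by_cases hy : y g (pt m s w (face j)) = true
    · by_cases hb : br m s c t g.val j = true
      · rw [if_pos ⟨hy, hiff.mpr hb⟩, if_pos ⟨hb, hy⟩]
      · rw [if_neg (fun h => hb (hiff.mp h.2)), if_neg (fun h => hb h.1)]
    · rw [if_neg (fun h => hy h.1), if_neg (fun h => hy h.2)]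
  -- the shadow's count is `T 0 + T 1 + T 2`
  have hcard : ((liveIdx m s c t).filter fun gj => y gj.1 (pt m s w (face gj.2)) = true).card = ∑ j : Fin 3, T j := by
    unfold liveIdx
    rw [Finset.filter_filter, Finset.card_filter, Finset.sum_product, Finset.sum_comm]
    refine Finset.sum_congr rfl fun j _ => ?_
    rw [hTbr j]
  have hodd : (T 0 + T 1 + T 2) % 2 = 1 := by
    have h0 := hcnt 0; have h1 := hcnt 1; have h2 := hcnt 2
    rw [hsplit] at h0 h1 h2
    omega
  unfold shadow
  rw [decide_eq_true_eq, hcard, Fin.sum_univ_three]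
  exact hodd

/-- **THE END-SHADOW LAW (finite form, every prime `p ≠ 3`, incl. `p = 2`).**  On `N = m + s + 2` bits: if the cuts at
positions `< m` do not read the last two bits, the cuts at positions `≥ m` have `𝔽_p`-degree `≤ d`, `3(s+3)·d < p^ℓ` and
`6p^ℓ ≤ m + 3`, then the strategy is NOT perfect (at every charge `c`). -/
theorem noPerfect_endReaders (p : ℕ) [hp : Fact p.Prime] (hp3 : p ≠ 3) {m s d ℓ N : ℕ} (hN : m + s + 2 = N)
    (hq : 3 * (s + 3) * d < p ^ ℓ) (hm : 6 * p ^ ℓ ≤ m + 3) (c : ℕ)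
    (y : Fin (N + 1) → (Fin N → Bool) → Bool)
    (hblind : ∀ g : Fin (N + 1), g.val < m → ∀ u u' : Fin N → Bool,
      (∀ i : Fin N, i.val < N - 2 → u i = u' i) → y g u = y g u')
    (hdeg : ∀ g : Fin (N + 1), m ≤ g.val → HasDegF p (y g) d) :
    ∃ u, ringWinU c y u = false := by
  subst hN
  have hblind' : ∀ g : Fin (m + s + 2 + 1), g.val < m → ∀ u u' : Fin (m + s + 2) → Bool,
      (∀ i : Fin (m + s + 2), i.val < m + s → u i = u' i) → y g u = y g u' := by
    intro g hg u u' huu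
    exact hblind g hg u u' (fun i hi => huu i (by omega))
  by_contra hcon
  have hwin : ∀ u, ringWinU c y u = true := fun u => by
    cases hh : ringWinU c y u
    · exact absurd ⟨u, hh⟩ hcon
    · rfl
  have hall : ∀ t, t < 3 → ∀ w : Fin m → Bool, shadow c y t w = true := by
    intro t ht3
    refine boolTrue_of_true_mod3 p hp3 (a := 2 * t) hq hm (hasDegF_shadow c hdeg t) (fun w hw => ?_)
    have ht' : (2 * wt w) % 3 = t := by omega
    rw [← ht']
    exact shadow_class c y hwin hblind' w
  have hx := shadow_xor3 c y (fun _ : Fin m => false)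
  rw [hall 0 (by norm_num), hall 1 (by norm_num), hall 2 (by norm_num)] at hx
  exact absurd hx (by decide)

/-- **THE ONLINE LAW (finite form).** A strategy with LOOKAHEAD `R` (cut `g` reads only the bits at positions `< g + R`;
`R = 0`: CAUSAL) whose last `R + 3` cuts have degree `≤ d` is not perfect once `3(R+3)d < p^ℓ`, `6p^ℓ + R + 2 ≤ n`. -/
theorem noPerfect_online (p : ℕ) [hp : Fact p.Prime] (hp3 : p ≠ 3) {n R d ℓ : ℕ} (hq : 3 * (R + 3) * d < p ^ ℓ)
    (hn : 6 * p ^ ℓ + R + 2 ≤ n) (c : ℕ) (y : Fin (n + 1) → (Fin n → Bool) → Bool)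
    (hon : ∀ g : Fin (n + 1), ∀ u u' : Fin n → Bool, (∀ i : Fin n, i.val < g.val + R → u i = u' i) → y g u = y g u')
    (hdeg : ∀ g : Fin (n + 1), n - R - 2 ≤ g.val → HasDegF p (y g) d) :
    ∃ u, ringWinU c y u = false :=
  noPerfect_endReaders p hp3 (m := n - R - 2) (s := R) (N := n) (by omega) hq (by omega) c y
    (fun g hg u u' huu => hon g u u' (fun i hi => huu i (by omega))) hdeg

end Law


section Scale

open Summit.QuantumAdvantage.AdviceFreeQNC0
open Literature.Computability.MetaComplexity Literature.Computability.MetaComplexity.Smolensky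

/-- scale bookkeeping: at polylog degree `L = (log₂ n)^C` and strip `s = L` a prime power `q = p^ℓ` with
`3(L+3)L < q` and `6q + L + 2 ≤ n` exists for all large `n`. -/
theorem exists_scale (p : ℕ) (hp : 2 ≤ p) (C : ℕ) :
    ∃ n₀ : ℕ, ∀ n ≥ n₀, ∃ ℓ : ℕ,
      3 * ((Nat.log 2 n) ^ C + 3) * (Nat.log 2 n) ^ C < p ^ ℓ ∧ 6 * p ^ ℓ + (Nat.log 2 n) ^ C + 2 ≤ n := by
  obtain ⟨n₁, hn₁⟩ := TubePlanProof.logPow_le_natSqrt (2 * C + 1)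
  refine ⟨max n₁ (2 ^ (75 * p)), fun n hn => ?_⟩
  have hn1 : n₁ ≤ n := le_trans (le_max_left _ _) hn
  have hn2 : 2 ^ (75 * p) ≤ n := le_trans (le_max_right _ _) hn
  have hlog : 75 * p ≤ Nat.log 2 n := by
    have h := Nat.log_mono_right (b := 2) hn2
    rwa [Nat.log_pow (by norm_num)] at h
  set L := (Nat.log 2 n) ^ C with hL
  set M := 3 * (L + 3) * L with hM
  have hL1 : 1 ≤ L := Nat.one_le_pow _ _ (by omega)
  have hMpos : 0 < M := by rw [hM]; exact Nat.mul_pos (Nat.mul_pos (by norm_num) (by omega)) (by omega)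
  have hM0 : M ≠ 0 := hMpos.ne'
  refine ⟨Nat.log p M + 1, Nat.lt_pow_succ_log_self hp M, ?_⟩
  have hpow : p ^ (Nat.log p M + 1) ≤ p * M := by
    rw [pow_succ']; exact Nat.mul_le_mul_left _ (Nat.pow_log_le_self p hM0)
  have hsq : (Nat.log 2 n) ^ (2 * C + 1) ≤ Nat.sqrt n := hn₁ n hn1
  have hL2 : L ≤ L ^ 2 := by rw [pow_two]; exact Nat.le_mul_of_pos_left L (by omega)
  have hpl : p * L ≤ p * L ^ 2 := Nat.mul_le_mul_left _ hL2
  have hpL2 : L ^ 2 ≤ p * L ^ 2 := Nat.le_mul_of_pos_left _ (by omega)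
  calc 6 * p ^ (Nat.log p M + 1) + L + 2 ≤ 6 * (p * M) + L + 2 := by omega
    _ = 18 * (p * L ^ 2) + 54 * (p * L) + L + 2 := by rw [hM]; ring
    _ ≤ 18 * (p * L ^ 2) + 54 * (p * L ^ 2) + L ^ 2 + 2 * L ^ 2 := by omega
    _ = 72 * (p * L ^ 2) + 3 * L ^ 2 := by ring
    _ ≤ 72 * (p * L ^ 2) + 3 * (p * L ^ 2) := by omega
    _ = (75 * p) * L ^ 2 := by ring
    _ ≤ Nat.log 2 n * L ^ 2 := Nat.mul_le_mul_right _ hlog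
    _ = (Nat.log 2 n) ^ (2 * C + 1) := by rw [hL]; ring
    _ ≤ Nat.sqrt n := hsq
    _ ≤ n := Nat.sqrt_le_self n

/-- **the end-shadow law at polylog scale** (the statement of lens-4 g22's piece `W = NoPerfectEndObliviousOdd`,
spelled out): degree `≤ (log₂ n)^C` everywhere, every cut farther than `(log₂ n)^C + 2` from the right end blind to the
last two bits ⟹ not perfect, for every prime `p ≥ 5` and all large `n`. -/
theorem noPerfect_endOblivious_polylog (p : ℕ) [Fact p.Prime] (hp : 5 ≤ p) (C : ℕ) :
    ∃ n₀ : ℕ, ∀ n ≥ n₀, ∀ c : ℕ, ∀ y : Fin (n + 1) → (Fin n → Bool) → Bool,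
      (∀ g, HasDegF p (y g) ((Nat.log 2 n) ^ C)) →
      (∀ g : Fin (n + 1), g.val + (Nat.log 2 n) ^ C + 2 < n →
        ∀ u u' : Fin n → Bool, (∀ i : Fin n, i.val < n - 2 → u i = u' i) → y g u = y g u') →
      ∃ u, ringWinU c y u = false := by
  obtain ⟨n₀, hn₀⟩ := exists_scale p (by omega) C
  refine ⟨n₀, fun n hn c y hy hob => ?_⟩
  obtain ⟨ℓ, hq, h6⟩ := hn₀ n hn
  exact noPerfect_endReaders p (by omega) (m := n - (Nat.log 2 n) ^ C - 2) (s := (Nat.log 2 n) ^ C)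
    (d := (Nat.log 2 n) ^ C) (N := n) (by omega) hq (by omega) c y (fun g hg => hob g (by omega)) (fun g _ => hy g)

/-- **the wild form**: only the last `(log₂ n)^C + 3` cuts need polylog degree; the blind interior cuts are arbitrary. -/
theorem noPerfect_endObliviousWild_polylog (p : ℕ) [Fact p.Prime] (hp : 5 ≤ p) (C : ℕ) :
    ∃ n₀ : ℕ, ∀ n ≥ n₀, ∀ c : ℕ, ∀ y : Fin (n + 1) → (Fin n → Bool) → Bool,
      (∀ g : Fin (n + 1), n ≤ g.val + (Nat.log 2 n) ^ C + 2 → HasDegF p (y g) ((Nat.log 2 n) ^ C)) →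
      (∀ g : Fin (n + 1), g.val + (Nat.log 2 n) ^ C + 2 < n →
        ∀ u u' : Fin n → Bool, (∀ i : Fin n, i.val < n - 2 → u i = u' i) → y g u = y g u') →
      ∃ u, ringWinU c y u = false := by
  obtain ⟨n₀, hn₀⟩ := exists_scale p (by omega) C
  refine ⟨n₀, fun n hn c y hy hob => ?_⟩
  obtain ⟨ℓ, hq, h6⟩ := hn₀ n hn
  exact noPerfect_endReaders p (by omega) (m := n - (Nat.log 2 n) ^ C - 2) (s := (Nat.log 2 n) ^ C)
    (d := (Nat.log 2 n) ^ C) (N := n) (by omega) hq (by omega) c y (fun g hg => hob g (by omega))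
    (fun g hg => hy g (by omega))

/-- **no perfect ONLINE strategy at polylog scale**: lookahead and degree `(log₂ n)^C`. -/
theorem noPerfect_online_polylog (p : ℕ) [Fact p.Prime] (hp : 5 ≤ p) (C : ℕ) :
    ∃ n₀ : ℕ, ∀ n ≥ n₀, ∀ c : ℕ, ∀ y : Fin (n + 1) → (Fin n → Bool) → Bool,
      (∀ g, HasDegF p (y g) ((Nat.log 2 n) ^ C)) →
      (∀ g : Fin (n + 1), ∀ u u' : Fin n → Bool,
        (∀ i : Fin n, i.val < g.val + (Nat.log 2 n) ^ C → u i = u' i) → y g u = y g u') →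
      ∃ u, ringWinU c y u = false := by
  obtain ⟨n₀, hn₀⟩ := noPerfect_endOblivious_polylog p hp C
  exact ⟨n₀, fun n hn c y hy hon => hn₀ n hn c y hy
    (fun g hg u u' huu => hon g u u' (fun i hi => huu i (by omega)))⟩

end Scale

end Summit.QuantumAdvantage.QuantumAdvantage.Theorems.ReadDial
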